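import Summits.Ventures.PercRepro.Night2LineStructure

/-!
# night-2: the LINE regime — the sharp structural bound: all but `≤ 25` points of `W` on a basis line (gen 38)

Sort the active faces by their requests `r_c ≥ r_d ≥ r_e ≥ …` (`r = 7/(6(m + 2))`, decreasing in `m`).  The lossy constraint
`11/18 < Σ r ≤ r_c + r_d + 3 r_e` with `m_c ≤ m_d ≤ m_e` forces `m_c + m_d + m_e ≤ 28` (`sum_three_le_of_sorted`: `m_c ≤ 7`,
`m_d ≤ 10` as in `Night2LineStructure`, then a finite check over `(m_c, m_d)` with `m_e ≥ 29 − m_c − m_d`; the extremal profile is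
`(3, 3, 22)` with `Σ r = 0.6125`).  Hence **`exists_pair_card_sdiff_clF_le_25`**: every lossy non-fat basis pair has two basis points
whose line carries all but `≤ 25` points of `W`.  Paper: proofs/NIGHT-2-g38.md §4.
-/

namespace PercRepro.Shadow

open PercRepro.ThmH PercRepro.PerFlat

variable {α : Type*} [DecidableEq α] {M : Matroid α} [M.Finite] {G : Finset α}

/-- The request `7/(6(m + 2))` is antitone in `m`. -/
theorem req_term_anti {m m' : ℕ} (h : m ≤ m') : (7 : ℚ) / (6 * ((m' : ℚ) + 2)) ≤ 7 / (6 * ((m : ℚ) + 2)) := by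
  have h' : (m : ℚ) ≤ (m' : ℚ) := by exact_mod_cast h
  apply div_le_div_of_nonneg_left (by norm_num) (by positivity)
  linarith

/-- **The sorted profile bound**: `3 ≤ m₁ ≤ m₂ ≤ m₃` and `11/18 < r₁ + r₂ + 3 r₃` force `m₁ + m₂ + m₃ ≤ 28`. -/
theorem sum_three_le_of_sorted {m₁ m₂ m₃ : ℕ} (h1 : 3 ≤ m₁) (h12 : m₁ ≤ m₂) (h23 : m₂ ≤ m₃)
    (hF : 11 / 18 < (7 : ℚ) / (6 * ((m₁ : ℚ) + 2)) + 7 / (6 * ((m₂ : ℚ) + 2)) + 3 * (7 / (6 * ((m₃ : ℚ) + 2)))) :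
    m₁ + m₂ + m₃ ≤ 28 := by
  have hr12 := req_term_anti h12
  have hr23 := req_term_anti h23
  -- `m₁ ≤ 7`
  have hm1 : m₁ ≤ 7 := by
    by_contra h
    have h8 : (8 : ℚ) ≤ (m₁ : ℚ) := by exact_mod_cast (by omega : 8 ≤ m₁)
    have : (7 : ℚ) / (6 * ((m₁ : ℚ) + 2)) ≤ 7 / 60 := by
      rw [div_le_div_iff₀ (by positivity) (by norm_num)]
      linarith
    linarith
  -- `m₂ ≤ 10`
  have hm2 : m₂ ≤ 10 := by
    by_contra h
    have h11 : (11 : ℚ) ≤ (m₂ : ℚ) := by exact_mod_cast (by omega : 11 ≤ m₂)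
    have hb1 : (7 : ℚ) / (6 * ((m₁ : ℚ) + 2)) ≤ 7 / 30 := by
      have h3 : (3 : ℚ) ≤ (m₁ : ℚ) := by exact_mod_cast h1
      rw [div_le_div_iff₀ (by positivity) (by norm_num)]
      linarith
    have : (7 : ℚ) / (6 * ((m₂ : ℚ) + 2)) ≤ 7 / 78 := by
      rw [div_le_div_iff₀ (by positivity) (by norm_num)]
      linarith
    linarith
  by_contra hge
  have hm3 : 29 - m₁ - m₂ ≤ m₃ := by omega
  have hm3' : ((29 - m₁ - m₂ : ℕ) : ℚ) ≤ (m₃ : ℚ) := by exact_mod_cast hm3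
  have hr3 := req_term_anti hm3
  interval_cases m₁ <;> interval_cases m₂ <;> norm_num at hr3 hF hm3' ⊢ <;> linarith

/-- `Σ_{w ∈ A} r w ≤ r c + r d + 3 r e` when `c, d, e` are the three largest values of `r` on `A` (`|A| ≤ 5`). -/
theorem sum_le_three_max {A : Finset α} (r : α → ℚ) (hA : A.card ≤ 5) (hr0 : ∀ w ∈ A, 0 ≤ r w)
    {c d e : α} (hc : c ∈ A) (hd : d ∈ A.erase c) (he : e ∈ (A.erase c).erase d)
    (hmax : ∀ w ∈ ((A.erase c).erase d).erase e, r w ≤ r e) :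
    ∑ w ∈ A, r w ≤ r c + r d + 3 * r e := by
  rw [← Finset.add_sum_erase A r hc, ← Finset.add_sum_erase (A.erase c) r hd,
    ← Finset.add_sum_erase ((A.erase c).erase d) r he]
  have hcard : (((A.erase c).erase d).erase e).card ≤ 2 := by
    rw [Finset.card_erase_of_mem he, Finset.card_erase_of_mem hd, Finset.card_erase_of_mem hc]
    omega
  have hre : 0 ≤ r e := hr0 e (Finset.mem_of_mem_erase (Finset.mem_of_mem_erase he))
  have := sum_le_card_mul_of_le r hre hcard hmax
  push_cast at this
  linarith

/-- **Every lossy non-fat basis pair has two basis points whose line carries all but at most `25` points of `W`.** -/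
theorem exists_pair_card_sdiff_clF_le_25 (hG : G ∈ flatsQ M (5 + 1)) (hd : (gr M \ G).card = 2)
    (hk : kColoops M G = 1) (hnf : fatClosures M 5 G 2 = ∅) {B : Finset α}
    (hB : B ∈ thinMembers M 5 G) (hnP : ¬ bigP M G B) {z : α} (hz : z ∈ G \ clF M B)
    (hl0 : loss M 5 G B z ≠ 0) :
    ∃ a ∈ insert z B \ coloops M G, ∃ b ∈ insert z B \ coloops M G, a ≠ b ∧
      ((G \ insert z B) \ clF M {a, b}).card ≤ 25 := by
  have hd' : (gr M \ G).card ≤ 5 := by omega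
  have hQG : insert z B ⊆ G := Finset.insert_subset (Finset.mem_sdiff.1 hz).1 (subset_G_of_mem_thinMembers hB)
  have hKB : coloops M G ⊆ B := coloops_subset_of_mem_thinMembers hG hd' hB
  obtain ⟨-, hQ'5⟩ := rkN_insert_sdiff_coloops_eq_five hG hd hk hB hnP hz
  -- the requests of the active faces sum to more than `11/18`
  have hcap := capS_ge_eleven_eighteenths_two_one hd hk hQG
  have hlt := capS_lt_L1_of_loss_ne_zero hl0
  rw [L1_eq_sum_req_faces hG hd] at hlt
  have hsum : 11 / 18 < ∑ w ∈ (insert z B \ coloops M G).filter (fun w => faceOk M G (insert z B) w),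
      req M 5 ((insert z B).erase w) := by linarith
  have hAcard : ((insert z B \ coloops M G).filter (fun w => faceOk M G (insert z B) w)).card ≤ 5 := by
    rw [← hQ'5]
    exact Finset.card_filter_le _ _
  have hok : ∀ w ∈ (insert z B \ coloops M G).filter (fun w => faceOk M G (insert z B) w),
      faceOk M G (insert z B) w := fun w hw => (Finset.mem_filter.1 hw).2
  -- the requests in terms of `m_w`
  have hreq : ∀ w ∈ (insert z B \ coloops M G).filter (fun w => faceOk M G (insert z B) w),
      req M 5 ((insert z B).erase w) = 7 / (6 * (((G \ clF M ((insert z B).erase w)).card : ℚ) + 2)) := by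
    intro w hw
    rw [req_eq_of_thin hG (hok w hw).1, hd]
    unfold phiQ
    push_cast
    rw [div_div]
    norm_num
  have hm3 : ∀ w ∈ (insert z B \ coloops M G).filter (fun w => faceOk M G (insert z B) w),
      3 ≤ (G \ clF M ((insert z B).erase w)).card := fun w hw =>
    three_le_card_sdiff_of_nonfat hnf (hok w hw).1
  -- the three faces of largest request
  have hne : ((insert z B \ coloops M G).filter (fun w => faceOk M G (insert z B) w)).Nonempty := by
    rw [← Finset.card_pos]
    have := three_le_card_faceOk_of_loss_ne_zero hG hd hk hnf hB hz hl0
    omega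
  obtain ⟨c, hcA, hcmax⟩ := Finset.exists_max_image _ (fun w => req M 5 ((insert z B).erase w)) hne
  have hne1 : (((insert z B \ coloops M G).filter (fun w => faceOk M G (insert z B) w)).erase c).Nonempty := by
    rw [← Finset.card_pos, Finset.card_erase_of_mem hcA]
    have := three_le_card_faceOk_of_loss_ne_zero hG hd hk hnf hB hz hl0
    omega
  obtain ⟨d, hdA, hdmax⟩ := Finset.exists_max_image _ (fun w => req M 5 ((insert z B).erase w)) hne1
  have hne2 : ((((insert z B \ coloops M G).filter (fun w => faceOk M G (insert z B) w)).erase c).erase d).Nonempty := by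
    rw [← Finset.card_pos, Finset.card_erase_of_mem hdA, Finset.card_erase_of_mem hcA]
    have := three_le_card_faceOk_of_loss_ne_zero hG hd hk hnf hB hz hl0
    omega
  obtain ⟨e, heA, hemax⟩ := Finset.exists_max_image _ (fun w => req M 5 ((insert z B).erase w)) hne2
  have hdA' := Finset.mem_of_mem_erase hdA
  have heA' := Finset.mem_of_mem_erase (Finset.mem_of_mem_erase heA)
  have hcd : c ≠ d := fun h => (Finset.mem_erase.1 hdA).1 h.symm
  have hce : c ≠ e := fun h => (Finset.mem_erase.1 (Finset.mem_of_mem_erase heA)).1 h.symm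
  have hde : d ≠ e := fun h => (Finset.mem_erase.1 heA).1 h.symm
  have hF : 11 / 18 < req M 5 ((insert z B).erase c) + req M 5 ((insert z B).erase d) +
      3 * req M 5 ((insert z B).erase e) := by
    refine lt_of_lt_of_le hsum (sum_le_three_max _ hAcard (fun w _ => req_nonneg _ _) hcA hdA heA ?_)
    intro w hw
    exact hemax w (Finset.mem_of_mem_erase hw)
  -- the ordering of the `m`'s
  have hrcd : req M 5 ((insert z B).erase d) ≤ req M 5 ((insert z B).erase c) := hcmax d hdA'
  have hrde : req M 5 ((insert z B).erase e) ≤ req M 5 ((insert z B).erase d) :=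
    hdmax e (Finset.mem_of_mem_erase heA)
  have hmono : ∀ w ∈ (insert z B \ coloops M G).filter (fun w => faceOk M G (insert z B) w),
      ∀ w' ∈ (insert z B \ coloops M G).filter (fun w => faceOk M G (insert z B) w),
      req M 5 ((insert z B).erase w') ≤ req M 5 ((insert z B).erase w) →
      (G \ clF M ((insert z B).erase w)).card ≤ (G \ clF M ((insert z B).erase w')).card := by
    intro w hw w' hw' hle
    rw [hreq w hw, hreq w' hw'] at hle
    by_contra hlt'
    have hlt'' : (G \ clF M ((insert z B).erase w')).card + 1 ≤ (G \ clF M ((insert z B).erase w)).card := by omega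
    have hq : ((G \ clF M ((insert z B).erase w')).card : ℚ) + 1 ≤ ((G \ clF M ((insert z B).erase w)).card : ℚ) := by
      exact_mod_cast hlt''
    rw [div_le_div_iff₀ (by positivity) (by positivity)] at hle
    linarith
  have hmcd := hmono c hcA d hdA' hrcd
  have hmde := hmono d hdA' e heA' hrde
  rw [hreq c hcA, hreq d hdA', hreq e heA'] at hF
  have hsum3 := sum_three_le_of_sorted (hm3 c hcA) hmcd hmde hF
  -- holes
  have hhc := card_holes_le hG hd hk hB hnP hz (Finset.mem_sdiff.1 (Finset.mem_filter.1 hcA).1).1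
  have hhd := card_holes_le hG hd hk hB hnP hz (Finset.mem_sdiff.1 (Finset.mem_filter.1 hdA').1).1
  have hhe := card_holes_le hG hd hk hB hnP hz (Finset.mem_sdiff.1 (Finset.mem_filter.1 heA').1).1
  -- the two remaining basis points and the cover (as in `exists_pair_card_sdiff_clF_le`)
  have hcQ' : c ∈ insert z B \ coloops M G := (Finset.mem_filter.1 hcA).1
  have hdQ' : d ∈ insert z B \ coloops M G := (Finset.mem_filter.1 hdA').1
  have heQ' : e ∈ insert z B \ coloops M G := (Finset.mem_filter.1 heA').1
  have hCQ' : ({c, d, e} : Finset α) ⊆ insert z B \ coloops M G := by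
    intro x hx
    rw [Finset.mem_insert, Finset.mem_insert, Finset.mem_singleton] at hx
    rcases hx with rfl | rfl | rfl
    · exact hcQ'
    · exact hdQ'
    · exact heQ'
  have hC3 : ({c, d, e} : Finset α).card = 3 := by
    rw [Finset.card_insert_of_notMem, Finset.card_pair hde]
    rw [Finset.mem_insert, Finset.mem_singleton]
    push Not
    exact ⟨hcd, hce⟩
  have hrest : ((insert z B \ coloops M G) \ {c, d, e}).card = 2 := by
    rw [Finset.card_sdiff_of_subset hCQ', hQ'5, hC3]
  obtain ⟨a, b, hab, hab_eq⟩ := Finset.card_eq_two.1 hrest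
  have haQ' : a ∈ insert z B \ coloops M G := by
    have : a ∈ (insert z B \ coloops M G) \ {c, d, e} := by
      rw [hab_eq]
      exact Finset.mem_insert_self _ _
    exact (Finset.mem_sdiff.1 this).1
  have hbQ' : b ∈ insert z B \ coloops M G := by
    have : b ∈ (insert z B \ coloops M G) \ {c, d, e} := by
      rw [hab_eq]
      exact Finset.mem_insert_of_mem (Finset.mem_singleton_self _)
    exact (Finset.mem_sdiff.1 this).1
  refine ⟨a, haQ', b, hbQ', hab, ?_⟩
  have hcomm : (insert z B \ {c, d, e}) \ coloops M G = (insert z B \ coloops M G) \ {c, d, e} := by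
    ext x
    simp only [Finset.mem_sdiff]
    constructor
    · rintro ⟨⟨h1, h2⟩, h3⟩
      exact ⟨⟨h1, h3⟩, h2⟩
    · rintro ⟨⟨h1, h2⟩, h3⟩
      exact ⟨⟨h1, h3⟩, h2⟩
  have hcover : (G \ insert z B) \ clF M {a, b} ⊆
      ((G \ insert z B) \ clF M ((insert z B).erase c)) ∪
        (((G \ insert z B) \ clF M ((insert z B).erase d)) ∪
          ((G \ insert z B) \ clF M ((insert z B).erase e))) := by
    intro y hy
    rw [Finset.mem_sdiff] at hy
    obtain ⟨hyW, hyl⟩ := hy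
    have hyG : y ∈ G := (Finset.mem_sdiff.1 hyW).1
    by_contra hnot
    simp only [Finset.mem_union, Finset.mem_sdiff, not_or, not_and, not_not] at hnot
    obtain ⟨h1, h2, h3⟩ := hnot
    have hyW' := Finset.mem_sdiff.1 hyW
    have hyall : ∀ w ∈ ({c, d, e} : Finset α), y ∈ clF M ((insert z B).erase w) := by
      intro w hw
      rw [Finset.mem_insert, Finset.mem_insert, Finset.mem_singleton] at hw
      rcases hw with rfl | rfl | rfl
      · exact h1 hyW'
      · exact h2 hyW'
      · exact h3 hyW'
    have hy1 := dead_mem_clF_of_three hG hd hk hB hnP hz (hCQ'.trans Finset.sdiff_subset) hyG hyall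
    have hyK : y ∈ G \ coloops M G := by
      rw [Finset.mem_sdiff]
      exact ⟨hyG, fun h => (Finset.mem_sdiff.1 hyW).2 (Finset.mem_insert_of_mem (hKB h))⟩
    have hy2 := mem_clF_sdiff_coloops_of_mem_clF hG hk (Finset.sdiff_subset.trans hQG) hyK hy1
    rw [hcomm, hab_eq] at hy2
    exact hyl hy2
  have hcard := Finset.card_le_card hcover
  have hu1 := Finset.card_union_le ((G \ insert z B) \ clF M ((insert z B).erase c))
    (((G \ insert z B) \ clF M ((insert z B).erase d)) ∪ ((G \ insert z B) \ clF M ((insert z B).erase e)))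
  have hu2 := Finset.card_union_le ((G \ insert z B) \ clF M ((insert z B).erase d))
    ((G \ insert z B) \ clF M ((insert z B).erase e))
  omega

end PercRepro.Shadow
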